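import Summits.KontsevichZagierPeriods.KontsevichZagierPeriods.Theses.IsogenyCertificates
import Summits.KontsevichZagierPeriods.KontsevichZagierPeriods.Theorems.IsogenyCertificatesJLPairIdentityOneIntegrability
import Summits.KontsevichZagierPeriods.KontsevichZagierPeriods.Theorems.XMapPeriodTransfer.Negative.ValueSide
import Literature.NumberTheory.Transcendental.KZSemialgebraicComplex
import Literature.NumberTheory.Transcendental.SemialgebraicLineDeriv

/-!
# `JLPairIdentityOne`: the two representations exist (non-vacuity) and the item reduces to one pair
(support of stmt-KontsevichZagierPeriods-14654, route IsogenyCertificates)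

The item quantifies over all `KZ.IntegralRep 1`'s `r`, `r'` with prescribed domains `(−1/4, 0)`, `(−∞, −1)`
and integrands `1/√f_X`, `(−10−6u)/√f_C` on them. Using the integrability of
`IsogenyCertificatesJLPairIdentityOneIntegrability` and the Tarski–Seidenberg lemmas of the tree:
* `exists_rep_X`, `exists_rep_C`, `nonvacuous`: such representations EXIST (so the item is not vacuously
  true, and the representations are available to any chain of moves);
* `jlPairIdentityOne_of_pair`: it suffices to join ONE such pair by the moves (same domain + integrands
  agreeing on it ⇒ equivalent by one integrand-additivity move, `equivalent_of_eqOn`).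

References: M. Kontsevich, D. Zagier, *Periods* (2001), §1.1–1.2; J. Bochnak, M. Coste, M.-F. Roy,
*Real Algebraic Geometry* (1998), §2.2.
-/

noncomputable section

open Set MeasureTheory
open Literature.NumberTheory.Transcendental Literature.ModelTheory.ExponentialFields
open Summit.KontsevichZagierPeriods.IsogenyCertificates.XMapPeriodTransferValue (equivalent_of_eqOn)
open Summit.KontsevichZagierPeriods.IsogenyCertificates.JLPairIdentityOneIntegrability

namespace Summit.KontsevichZagierPeriods.IsogenyCertificates.JLPairIdentityOneReps

/-! ### The two representations on `ℝ¹ = Fin 1 → ℝ` -/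

/-- The oval `{−1/4 < p 0 < 0} ⊆ ℝ¹` is `ℚ`-semialgebraic. [cite: BochnakCosteRoy1998, §2.1] -/
theorem isSemialgebraic_domX : IsSemialgebraic ℚ {p : Fin 1 → ℝ | -1 / 4 < p 0 ∧ p 0 < 0} := by
  have h1 := isSemialgebraic_setOf_eval_pos (k := ℚ) (R := ℝ) (4 * MvPolynomial.X 0 + 1 :
      MvPolynomial (Fin 1) ℚ)
  have h2 := isSemialgebraic_setOf_eval_pos (k := ℚ) (R := ℝ) (-MvPolynomial.X 0 : MvPolynomial
      (Fin 1) ℚ)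
  convert h1.inter h2 using 1
  ext p
  simp only [mem_setOf_eq, mem_inter_iff, map_add, map_one, map_neg, map_mul,
      MvPolynomial.aeval_X, map_ofNat]
  constructor
  · rintro ⟨ha, hb⟩; exact ⟨by linarith, by linarith⟩
  · rintro ⟨ha, hb⟩; exact ⟨by linarith, by linarith⟩

/-- The branch `{p 0 < −1} ⊆ ℝ¹` is `ℚ`-semialgebraic. [cite: BochnakCosteRoy1998, §2.1] -/
theorem isSemialgebraic_domC : IsSemialgebraic ℚ {p : Fin 1 → ℝ | p 0 < -1} := by
  have h := isSemialgebraic_setOf_eval_pos (k := ℚ) (R := ℝ) (-MvPolynomial.X 0 - 1 : MvPolynomial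
      (Fin 1) ℚ)
  convert h using 1
  ext p
  simp only [mem_setOf_eq, map_sub, map_one, map_neg, MvPolynomial.aeval_X]
  constructor <;> intro h <;> linarith

/-- `p ↦ 1/√f_X(p 0)` is `ℚ`-semialgebraic on the oval (polynomial, square root, quotient:
Tarski–Seidenberg lemmas
of the tree). [cite: BochnakCosteRoy1998, Prop. 2.2.6] -/
theorem isSemialgebraicFunOn_integrandX :
    IsSemialgebraicFunOn ℚ {p : Fin 1 → ℝ | -1 / 4 < p 0 ∧ p 0 < 0} (fun p =>
      1 / Real.sqrt (-(p 0) * (9 * p 0 + 4) * (4 * p 0 + 1) * (172 * p 0 ^ 3 + 176 * p 0 ^ 2 + 60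
          * p 0 + 7))) := by
  set P : MvPolynomial (Fin 1) ℚ := -MvPolynomial.X 0 * (9 * MvPolynomial.X 0 + 4) * (4 *
      MvPolynomial.X 0 + 1) *
    (172 * MvPolynomial.X 0 ^ 3 + 176 * MvPolynomial.X 0 ^ 2 + 60 * MvPolynomial.X 0 + 7) with hP
  have hPe : ∀ p : Fin 1 → ℝ, MvPolynomial.aeval p P =
      -(p 0) * (9 * p 0 + 4) * (4 * p 0 + 1) * (172 * p 0 ^ 3 + 176 * p 0 ^ 2 + 60 * p 0 + 7) :=
          fun p => by
    simp [hP]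
  have hs := isSemialgebraic_domX
  have h1 : IsSemialgebraicFunOn ℚ {p : Fin 1 → ℝ | -1 / 4 < p 0 ∧ p 0 < 0} (fun p =>
      MvPolynomial.aeval p P) :=
    isSemialgebraicFunOn_aeval hs P
  have h2 := IsSemialgebraicFunOn.sqrt_holds h1
  have h3 := IsSemialgebraicFunOn.div (isSemialgebraicFunOn_const_ratCast hs 1) h2 fun p hp => by
    rw [hPe]; exact (Real.sqrt_pos.2 (fX_pos hp.1 hp.2)).ne'
  refine h3.congr fun p _ => ?_
  simp only [hPe, Rat.cast_one]

/-- `p ↦ (−10−6p 0)/√f_C(p 0)` is `ℚ`-semialgebraic on the branch. [cite: BochnakCosteRoy1998,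
Prop. 2.2.6] -/
theorem isSemialgebraicFunOn_integrandC :
    IsSemialgebraicFunOn ℚ {p : Fin 1 → ℝ | p 0 < -1} (fun p =>
      (-10 - 6 * p 0) / Real.sqrt ((p 0 ^ 2 + 4) * (p 0 + 1) * (p 0 ^ 3 - 5 * p 0 ^ 2 + 3 * p 0 -
          19))) := by
  set P : MvPolynomial (Fin 1) ℚ := (MvPolynomial.X 0 ^ 2 + 4) * (MvPolynomial.X 0 + 1) *
    (MvPolynomial.X 0 ^ 3 - 5 * MvPolynomial.X 0 ^ 2 + 3 * MvPolynomial.X 0 - 19) with hP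
  set N : MvPolynomial (Fin 1) ℚ := -10 - 6 * MvPolynomial.X 0 with hN
  have hPe : ∀ p : Fin 1 → ℝ, MvPolynomial.aeval p P =
      (p 0 ^ 2 + 4) * (p 0 + 1) * (p 0 ^ 3 - 5 * p 0 ^ 2 + 3 * p 0 - 19) := fun p => by simp [hP]
  have hNe : ∀ p : Fin 1 → ℝ, MvPolynomial.aeval p N = -10 - 6 * p 0 := fun p => by simp [hN]
  have hs := isSemialgebraic_domC
  have h1 : IsSemialgebraicFunOn ℚ {p : Fin 1 → ℝ | p 0 < -1} (fun p => MvPolynomial.aeval p P) :=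
    isSemialgebraicFunOn_aeval hs P
  have h2 := IsSemialgebraicFunOn.sqrt_holds h1
  have h3 := IsSemialgebraicFunOn.div (isSemialgebraicFunOn_aeval hs N) h2 fun p hp => by
    rw [hPe]; exact (Real.sqrt_pos.2 (fC_pos hp)).ne'
  refine h3.congr fun p _ => ?_
  simp only [hPe, hNe]

/-- **The X-side representation exists**: `[(−1/4, 0), dx/√f_X]` is a genuine `KZ.IntegralRep 1`
with the literal
domain and integrand of the item. [cite: KontsevichZagier2001, §1.1] -/
theorem exists_rep_X : ∃ r : KZ.IntegralRep 1, r.domain = {x | -1/4 < x 0 ∧ x 0 < 0} ∧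
    r.integrand = fun x => 1 / Real.sqrt (-(x 0) * (9 * x 0 + 4) * (4 * x 0 + 1) *
      (172 * x 0 ^ 3 + 176 * x 0 ^ 2 + 60 * x 0 + 7)) := by
  have hmp := MeasureTheory.volume_preserving_funUnique (Fin 1) ℝ
  have hset : {x : Fin 1 → ℝ | -1/4 < x 0 ∧ x 0 < 0} = (MeasurableEquiv.funUnique (Fin 1) ℝ) ⁻¹'
      (Ioo (-1 / 4 : ℝ) 0) := by
    ext x; simp [MeasurableEquiv.funUnique, Fin.default_eq_zero]
  have hint : IntegrableOn (fun x : Fin 1 → ℝ => 1 / Real.sqrt (-(x 0) * (9 * x 0 + 4) * (4 * x 0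
      + 1) *
      (172 * x 0 ^ 3 + 176 * x 0 ^ 2 + 60 * x 0 + 7))) {x : Fin 1 → ℝ | -1/4 < x 0 ∧ x 0 < 0} := by
    rw [hset]
    have h := (hmp.integrableOn_comp_preimage (MeasurableEquiv.measurableEmbedding _)).mpr
        integrableOn_X
    refine IntegrableOn.congr_fun h (fun x _ => ?_) (measurableSet_Ioo.preimage
        (MeasurableEquiv.measurable _))
    simp [MeasurableEquiv.funUnique, Fin.default_eq_zero]
  exact ⟨{ domain := _, integrand := _,
           isSemialgebraic_domain := isSemialgebraic_domX,
           isSemialgebraicFunOn_integrand := isSemialgebraicFunOn_integrandX,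
           integrableOn := hint }, rfl, rfl⟩

/-- **The C-side representation exists**: `[(−∞, −1), (−10−6u)du/√f_C]` is a genuine
`KZ.IntegralRep 1` with the
literal domain and integrand of the item. [cite: KontsevichZagier2001, §1.1] -/
theorem exists_rep_C : ∃ r' : KZ.IntegralRep 1, r'.domain = {u | u 0 < -1} ∧
    r'.integrand = fun u => (-10 - 6 * u 0) / Real.sqrt ((u 0 ^ 2 + 4) * (u 0 + 1) *
      (u 0 ^ 3 - 5 * u 0 ^ 2 + 3 * u 0 - 19)) := by
  have hmp := MeasureTheory.volume_preserving_funUnique (Fin 1) ℝ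
  have hset : {u : Fin 1 → ℝ | u 0 < -1} = (MeasurableEquiv.funUnique (Fin 1) ℝ) ⁻¹' (Iio (-1 :
      ℝ)) := by
    ext x; simp [MeasurableEquiv.funUnique, Fin.default_eq_zero]
  have hint : IntegrableOn (fun u : Fin 1 → ℝ => (-10 - 6 * u 0) / Real.sqrt ((u 0 ^ 2 + 4) * (u 0
      + 1) *
      (u 0 ^ 3 - 5 * u 0 ^ 2 + 3 * u 0 - 19))) {u : Fin 1 → ℝ | u 0 < -1} := by
    rw [hset]
    have h := (hmp.integrableOn_comp_preimage (MeasurableEquiv.measurableEmbedding _)).mpr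
        integrableOn_C
    refine IntegrableOn.congr_fun h (fun x _ => ?_) (measurableSet_Iio.preimage
        (MeasurableEquiv.measurable _))
    simp [MeasurableEquiv.funUnique, Fin.default_eq_zero]
  exact ⟨{ domain := _, integrand := _,
           isSemialgebraic_domain := isSemialgebraic_domC,
           isSemialgebraicFunOn_integrand := isSemialgebraicFunOn_integrandC,
           integrableOn := hint }, rfl, rfl⟩

/-- **Non-vacuity of the item**: the hypotheses of `JLPairIdentityOne` are satisfiable. [cite:
KontsevichZagier2001, §1.1] -/
theorem nonvacuous : ∃ r r' : KZ.IntegralRep 1,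
    r.domain = {x | -1/4 < x 0 ∧ x 0 < 0} ∧
    EqOn r.integrand (fun x => 1 / Real.sqrt (-(x 0) * (9 * x 0 + 4) * (4 * x 0 + 1) *
      (172 * x 0 ^ 3 + 176 * x 0 ^ 2 + 60 * x 0 + 7))) r.domain ∧
    r'.domain = {u | u 0 < -1} ∧
    EqOn r'.integrand (fun u => (-10 - 6 * u 0) / Real.sqrt ((u 0 ^ 2 + 4) * (u 0 + 1) *
      (u 0 ^ 3 - 5 * u 0 ^ 2 + 3 * u 0 - 19))) r'.domain := by
  obtain ⟨r, h1, h2⟩ := exists_rep_X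
  obtain ⟨r', h3, h4⟩ := exists_rep_C
  exact ⟨r, r', h1, fun x _ => by rw [h2], h3, fun u _ => by rw [h4]⟩

/-- **Reduction to one pair.** To prove the item it suffices to join by the moves ONE pair `(r₀,
r₀')` carrying the
two domains and integrands: any other pair is move-equivalent to it representation by
    representation (same domain,
integrands agreeing on it: one integrand-additivity move, `equivalent_of_eqOn`). [cite:
KontsevichZagier2001, §1.2] -/
theorem jlPairIdentityOne_of_pair (r₀ r₀' : KZ.IntegralRep 1)
    (h1 : r₀.domain = {x | -1/4 < x 0 ∧ x 0 < 0})
    (h2 : EqOn r₀.integrand (fun x => 1 / Real.sqrt (-(x 0) * (9 * x 0 + 4) * (4 * x 0 + 1) *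
      (172 * x 0 ^ 3 + 176 * x 0 ^ 2 + 60 * x 0 + 7))) r₀.domain)
    (h3 : r₀'.domain = {u | u 0 < -1})
    (h4 : EqOn r₀'.integrand (fun u => (-10 - 6 * u 0) / Real.sqrt ((u 0 ^ 2 + 4) * (u 0 + 1) *
      (u 0 ^ 3 - 5 * u 0 ^ 2 + 3 * u 0 - 19))) r₀'.domain)
    (h : KZ.Equivalent r₀ r₀') :
    Summit.KontsevichZagierPeriods.KontsevichZagierPeriods.Theses.IsogenyCertificates.JLPairIdentityOne := by
  unfold Summit.KontsevichZagierPeriods.KontsevichZagierPeriods.Theses.IsogenyCertificates.JLPairIdentityOne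
  intro r r' hr1 hr2 hr3 hr4
  have hd : r₀.domain = r.domain := h1.trans hr1.symm
  have hd' : r₀'.domain = r'.domain := h3.trans hr3.symm
  have e1 : KZ.Equivalent r r₀ :=
    equivalent_of_eqOn r r₀ hd fun x hx => by rw [hr2 hx, h2 (hd ▸ hx)]
  have e2 : KZ.Equivalent r' r₀' :=
    equivalent_of_eqOn r' r₀' hd' fun u hu => by rw [hr4 hu, h4 (hd' ▸ hu)]
  exact e1.trans (h.trans e2.symm)

end Summit.KontsevichZagierPeriods.IsogenyCertificates.JLPairIdentityOneReps

end
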